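import Summits.QuantumFields.YangMills.Theorems.AlphaInputsT3ACv3LinearLiftSmoothGauge
import Literature.MathematicalPhysics.QuantumFieldTheory.Balaban1983to89.T4ReflectionConeSharp
import Literature.MathematicalPhysics.QuantumFieldTheory.Balaban1983to89.BlockAveragingTwoLevel
import HarnessLib

/-!
# `AlphaInputsT3ACv3LinearLiftSupport` — (LL+) ★★ LOCALITY OF THE SUP-SMALL EXACT LIFT: `liftS k A (b)` READS `A` ONLY ON THE COARSE BONDS ISSUING FROM CELLS WITHIN SUP-DISTANCE `3` OF THE
# CELL OF `b`; hence the LOCAL sup bound `|liftS k A b| ≤ C_S·(max of |A| over those bonds)/L^k` — the engine letter the STENCIL version of the Newton right inverse needs (★w4-19936 CLAIM R6-FLAT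
# 01:41:16Z, ★w3-19936 ACK 01:41:31Z: «`liftS k A b = 0` when `A` vanishes on the radius-2∕3 cell neighbourhood of `b`») — cell `ym3-torus`, width seat `ym-ust-19936-w2` (g2)

WHY.  In the regional∕stencil execution of RULING g24-№4 the correction `R u` on the block of `y` must be computable from the defect `u` on the stencil of `y` only (the defect is
controlled on `bondsIn k Ω` and nowhere else).  `liftS k A = S1 k A + dgrad (S0 k (Ψ_k(S1 k A)))`: the spreads `S0`, `S1` read the `3^d` cells `Near` a fine site (landed:
`S1_weight_eq_zero_of_not_near`, `S0_weight_eq_zero_of_not_near`); the new content is the locality of the (0.4) COBOUNDARY POTENTIAL: `Ψ_s(a)(y)` reads `a` only on the finest bonds with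
both ends in the `s`-block `B^s(y)` (§2), because the iterated (0.4)-linear average at a level-`s` bond reads only the two `s`-blocks of its ends (the linear shadow of the tree's
`T4ReflectionConeSharp.loopHol_congr₂`, §1) and the staircases∕block means of the recursion stay in their block (`T4Continuum.blockOf_walkEnd_take_stairWord`, `AbelianEML.blockOf_offPt`).
WHAT (no definitions except the radius-`r` neighbourhood predicate `NearR`).  §0 `wsum_congr`; §1 one level: `loopSum_congr₂`, `lineSite_eq_shiftN`, `axialSum_congr₂`,
★ `linAvg04_congr₂`, `stairSum_congr_block`, `stairMean_congr_block`, `ptMean_congr_block`; §2 all levels: ★ `linAvgIter_congr₂` (two `s`-blocks), ★★ `psiIter_congr_block` (one `s`-block);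
§3 ★ `S1_congr_near`, `S0_congr_near`; §4 `NearR`, `nearR_of_near`, `nearR_mono`, `nearR_of_coarse_step`, `qIdx_shift_cast`, `nearR_shift`; §5 ★★★ `liftS_congr_local`
(`A = A'` on the bonds `⟨y, μ⟩` with `NearR 3 b.src y` ⇒ `liftS k A b = liftS k A' b`), `liftS_eq_zero_of_local`, ★★ `abs_liftS_le_local` (`|liftS k A b| ≤ 18^d(2+(d+1)18^d)·M/L^k` from `|A| ≤ M` on
that neighbourhood only).
HONEST FRAMING.  Lattice bookkeeping over the landed (LL)∕(LL+) engine; count-neutral helper toward the (FL) row of 2′∕2′χ (`--supports stmt-QuantumFields-19936`); (FL)∕`hLift` is NOT proved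
here; registry untouched.  YM₃ on the three-torus is RUNG R3 of the programme, not the Clay problem; no claim about d = 4, infinite volume or a mass gap.

References: T. Bałaban, Commun. Math. Phys. 109 (1987) 249–301 [Balaban1987RG1] ((0.3) p.252, (0.4)+(0.11) p.253); Commun. Math. Phys. 98 (1985) 17–51 [Balaban1985Averaging]
(p.24, locality of the averaging operation).
-/

set_option autoImplicit false

noncomputable section

namespace Summit.QuantumFields.YangMills.Theorems.LinearLiftSpread

open Finset
open Literature.MathematicalPhysics.QuantumFieldTheory.Balaban1983to89
open Literature.MathematicalPhysics.QuantumFieldTheory.Balaban1983to89.T4Continuum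
open Literature.MathematicalPhysics.QuantumFieldTheory.Balaban1983to89.BlockAveraging (off Idx blockOf_src_of_mem_walk)
open Literature.MathematicalPhysics.QuantumFieldTheory.Balaban1983to89.BlockAveragingEMLProp2 (shiftN_apply)
open Literature.MathematicalPhysics.QuantumFieldTheory.Balaban1983to89.B10Eq47AxialChi (shiftN)
open Literature.MathematicalPhysics.QuantumFieldTheory.Balaban1983to89.T4ReflectionConeSharp (exists_tgt_eq_walkEnd_take blockOf_tgt_of_mem_walk blockOf_tgt_line)
open Literature.MathematicalPhysics.QuantumFieldTheory.Balaban1983to89.AveragingRT (lineSite line blockOf_lineSite)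
open Literature.MathematicalPhysics.QuantumFieldTheory.Balaban1983to89.B5Eq118OneStroke (iterBlockOf iterBlockOf_zero iterBlockOf_succ)
open Summit.QuantumFields.YangMills.Theorems.AbelianEML (wsum wsum_nil wsum_cons_true wsum_cons_false loopSum axialSum stairSum stairMean offPt linAvg04 linAvgIter linAvgIter_succ runSum
  wsum_replicate_true blockOf_offPt)
open Summit.QuantumFields.YangMills.Theorems.LinearLiftGauge (dgrad ptMean psiIter)
open Summit.QuantumFields.YangMills.Theorems.LinearLiftProfile
open Summit.QuantumFields.Balaban3D.Carriers (shift_apply_self shift_apply_ne)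

variable {P : Params} {j : ℕ}

/-! ## §0 Congruence of walk sums -/

/-- Two one-forms that agree on the bonds of the walk `(x, w)` have the same walk sum. [cite: Balaban1985Averaging, p.24] -/
theorem wsum_congr (a a' : PBond P j → ℝ) : ∀ (w : List (Letter P.d)) (x : Site P j), (∀ s ∈ walk x w, a s.bond = a' s.bond) → wsum a x w = wsum a' x w
  | [], x, _ => by rw [wsum_nil, wsum_nil]
  | (μ, true) :: w, x, h => by
    rw [wsum_cons_true, wsum_cons_true, h ⟨⟨x, μ⟩, true⟩ (by simp [walk]),
      wsum_congr a a' w (x.shift μ) fun s hs => h s (by simp [walk, hs])]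
  | (μ, false) :: w, x, h => by
    rw [wsum_cons_false, wsum_cons_false, h ⟨⟨x.unshift μ, μ⟩, false⟩ (by simp [walk]),
      wsum_congr a a' w (x.unshift μ) fun s hs => h s (by simp [walk, hs])]

/-! ## §1 One level: the (0.4)-linear average at `c` reads the two blocks of `c`; staircases and block means read their block -/

section OneLevel

variable (hj : j + 1 ≤ P.m + P.K)
include hj

/-- The loop sums of (0.4) at `c` depend only on the one-form on bonds with BOTH ends in `B(c₋) ∪ B(c₊)` (the walks of `loopWord` stay there: `blockOf_src_of_mem_walk`, `blockOf_tgt_of_mem_walk`).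
[cite: Balaban1987RG1, (0.4) p.253] -/
theorem loopSum_congr₂ (a a' : PBond P j → ℝ) (c : PBond P (j + 1))
    (h : ∀ b : PBond P j, (blockOf b.src = c.src ∨ blockOf b.src = c.tgt) → (blockOf b.tgt = c.src ∨ blockOf b.tgt = c.tgt) → a b = a' b) (i : Idx P) :
    loopSum a c i = loopSum a' c i :=
  wsum_congr a a' _ _ fun s hs => h s.bond (blockOf_src_of_mem_walk hj c i s hs) (blockOf_tgt_of_mem_walk hj c i s hs)

omit hj in
/-- The straight line of `c`: `shiftN (emb c₋) (dir c) t = lineSite c t`. [cite: Balaban1984PropagatorsI, (1.7) p.18] -/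
theorem lineSite_eq_shiftN (c : PBond P (j + 1)) (t : ℕ) : shiftN (emb c.src) c.dir t = lineSite c t := by
  funext κ
  rw [shiftN_apply]
  unfold lineSite
  by_cases hκ : κ = c.dir
  · subst hκ; simp
  · simp [hκ]

/-- The axial sum at `c` depends only on the one-form on bonds with both ends in `B(c₋) ∪ B(c₊)` (`blockOf_lineSite`, `blockOf_tgt_line`). [cite: Balaban1985Averaging, (14) p.19] -/
theorem axialSum_congr₂ (a a' : PBond P j → ℝ) (c : PBond P (j + 1))
    (h : ∀ b : PBond P j, (blockOf b.src = c.src ∨ blockOf b.src = c.tgt) → (blockOf b.tgt = c.src ∨ blockOf b.tgt = c.tgt) → a b = a' b) :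
    axialSum a c = axialSum a' c := by
  unfold axialSum
  rw [wsum_replicate_true, wsum_replicate_true]
  unfold runSum
  refine sum_congr rfl fun t ht => ?_
  rw [mem_range] at ht
  rw [lineSite_eq_shiftN]
  exact h (line c t) (blockOf_lineSite hj c ht) (blockOf_tgt_line hj c ht)

/-- **★ THE (0.4)-LINEAR AVERAGE IS TWO-BLOCK LOCAL**: `linAvg04 a c` depends only on `a` on the bonds with both ends in `B(c₋) ∪ B(c₊)` (linear shadow of `T4ReflectionConeSharp.avgFun_congr₂`).
[cite: Balaban1987RG1, (0.4) p.253] -/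
theorem linAvg04_congr₂ (a a' : PBond P j → ℝ) (c : PBond P (j + 1))
    (h : ∀ b : PBond P j, (blockOf b.src = c.src ∨ blockOf b.src = c.tgt) → (blockOf b.tgt = c.src ∨ blockOf b.tgt = c.tgt) → a b = a' b) :
    linAvg04 a c = linAvg04 a' c := by
  unfold linAvg04
  rw [axialSum_congr₂ hj a a' c h]
  congr 2
  exact sum_congr rfl fun i _ => loopSum_congr₂ hj a a' c h i

/-- A staircase sum from the centre of `B(y)` reads only bonds with both ends in `B(y)` (`blockOf_walkEnd_take_stairWord`). [cite: Balaban1987RG1, (0.3) p.252] -/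
theorem stairSum_congr_block (a a' : PBond P j → ℝ) (y : Site P (j + 1)) (h : ∀ b : PBond P j, blockOf b.src = y → blockOf b.tgt = y → a b = a' b)
    (r : Fin P.d → Fin P.L) (σ : Equiv.Perm (Fin P.d)) : stairSum a y (off r) σ = stairSum a' y (off r) σ := by
  unfold stairSum
  refine wsum_congr a a' _ _ fun s hs => h s.bond ?_ ?_
  · obtain ⟨i, hi⟩ := exists_src_eq_walkEnd_take _ _ s hs
    rw [hi]; exact blockOf_walkEnd_take_stairWord hj y r σ i
  · obtain ⟨i, hi⟩ := exists_tgt_eq_walkEnd_take _ _ s hs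
    rw [hi]; exact blockOf_walkEnd_take_stairWord hj y r σ i

/-- The staircase mean `Φ(a)(y)` reads only bonds with both ends in `B(y)`. [cite: Balaban1987RG1, (0.3) p.252] -/
theorem stairMean_congr_block (a a' : PBond P j → ℝ) (y : Site P (j + 1)) (h : ∀ b : PBond P j, blockOf b.src = y → blockOf b.tgt = y → a b = a' b) :
    stairMean a y = stairMean a' y := by
  unfold stairMean
  congr 1
  exact sum_congr rfl fun i _ => stairSum_congr_block hj a a' y h i.1 i.2.1

/-- The block mean `ptMean g y` reads `g` only on `B(y)` (`blockOf_offPt`). [cite: Balaban1987RG1, (0.3) p.252] -/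
theorem ptMean_congr_block (g g' : Site P j → ℝ) (y : Site P (j + 1)) (h : ∀ x : Site P j, blockOf x = y → g x = g' x) : ptMean g y = ptMean g' y := by
  unfold ptMean
  congr 1
  exact sum_congr rfl fun i _ => h _ (blockOf_offPt hj y i.1)

end OneLevel

/-! ## §2 All levels: `linAvgIter s` reads the two `s`-blocks, `Ψ_s` reads one `s`-block -/

/-- **★ THE ITERATED (0.4)-LINEAR AVERAGE IS TWO-`s`-BLOCK LOCAL**: `linAvgIter s a c` depends only on `a` on the finest bonds with both ends in `B^s(c₋) ∪ B^s(c₊)` (standing range).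
[cite: Balaban1987RG1, (0.4)+(0.11) p.253] -/
theorem linAvgIter_congr₂ (a a' : PBond P 0 → ℝ) : ∀ (s : ℕ), s ≤ P.m + P.K → ∀ (c : PBond P s),
    (∀ b : PBond P 0, (iterBlockOf s b.src = c.src ∨ iterBlockOf s b.src = c.tgt) → (iterBlockOf s b.tgt = c.src ∨ iterBlockOf s b.tgt = c.tgt) → a b = a' b) →
      linAvgIter s a c = linAvgIter s a' c
  | 0, _, c, h => h c (Or.inl rfl) (Or.inr rfl)
  | s + 1, hs, c, h => by
    rw [linAvgIter_succ, linAvgIter_succ]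
    refine linAvg04_congr₂ hs _ _ c fun b' h1 h2 => linAvgIter_congr₂ a a' s (Nat.le_of_succ_le hs) b' fun b hb1 hb2 => h b ?_ ?_
    · rw [iterBlockOf_succ]
      rcases hb1 with e | e
      · rw [e]; exact h1
      · rw [e]; exact h2
    · rw [iterBlockOf_succ]
      rcases hb2 with e | e
      · rw [e]; exact h1
      · rw [e]; exact h2

/-- **★★ THE (0.4) COBOUNDARY POTENTIAL IS ONE-`s`-BLOCK LOCAL**: `Ψ_s(a)(y)` depends only on `a` on the finest bonds with both ends in `B^s(y)` (the block means and staircases of the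
recursion stay in their block; the averages they read are two-sub-block local). [cite: Balaban1987RG1, (0.3) p.252, (0.4)+(0.11) p.253] -/
theorem psiIter_congr_block (a a' : PBond P 0 → ℝ) : ∀ (s : ℕ), s ≤ P.m + P.K → ∀ (y : Site P s),
    (∀ b : PBond P 0, iterBlockOf s b.src = y → iterBlockOf s b.tgt = y → a b = a' b) → psiIter s a y = psiIter s a' y
  | 0, _, _, _ => rfl
  | s + 1, hs, y, h => by
    have hs' : s ≤ P.m + P.K := Nat.le_of_succ_le hs
    show ptMean (psiIter s a) y + stairMean (linAvgIter s a) y = ptMean (psiIter s a') y + stairMean (linAvgIter s a') y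
    have hpt : ptMean (psiIter s a) y = ptMean (psiIter s a') y :=
      ptMean_congr_block hs (psiIter s a) (psiIter s a') y fun z hz =>
        psiIter_congr_block a a' s hs' z fun b hb1 hb2 => h b (by rw [iterBlockOf_succ, hb1, hz]) (by rw [iterBlockOf_succ, hb2, hz])
    have hst : stairMean (linAvgIter s a) y = stairMean (linAvgIter s a') y :=
      stairMean_congr_block hs (linAvgIter s a) (linAvgIter s a') y fun b' h1 h2 =>
        linAvgIter_congr₂ a a' s hs' b' fun b hb1 hb2 =>
          h b (by rw [iterBlockOf_succ]; rcases hb1 with e | e <;> rw [e] <;> assumption)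
            (by rw [iterBlockOf_succ]; rcases hb2 with e | e <;> rw [e] <;> assumption)
    rw [hpt, hst]

/-! ## §3 The spreads read the `3^d` cells near a fine site -/

variable (k : ℕ)

/-- `S1 k A (b)` depends only on `A ⟨y, dir b⟩` for the coarse `y` NEAR `b₋`. [cite: Balaban1987RG1, (0.4) p.253] -/
theorem S1_congr_near (A A' : PBond P k → ℝ) (b : PBond P 0) (h : ∀ y : Site P k, Near k b.src y → A ⟨y, b.dir⟩ = A' ⟨y, b.dir⟩) : S1 k A b = S1 k A' b := by
  unfold S1
  refine sum_congr rfl fun y _ => ?_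
  by_cases hy : Near k b.src y
  · rw [h y hy]
  · rw [S1_weight_eq_zero_of_not_near k b y hy, mul_zero, mul_zero]

/-- `S0 k Φ (x)` depends only on `Φ y` for the coarse `y` NEAR `x`. [cite: Balaban1987RG1, (0.1) p.251] -/
theorem S0_congr_near (Φ Φ' : Site P k → ℝ) (x : Site P 0) (h : ∀ y : Site P k, Near k x y → Φ y = Φ' y) : S0 k Φ x = S0 k Φ' x := by
  unfold S0
  refine sum_congr rfl fun y _ => ?_
  by_cases hy : Near k x y
  · rw [h y hy]
  · rw [S0_weight_eq_zero_of_not_near k x y hy, mul_zero, mul_zero]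

/-! ## §4 The radius-`r` cell neighbourhood -/

/-- **`y` IS WITHIN `r` CELLS OF `x`**: in every coordinate the cell index of `y` differs from that of `x` by at most `r` (on the circle). `NearR 1 = Near`. [folklore] -/
def NearR (r : ℕ) (x : Site P 0) (y : Site P k) : Prop :=
  ∀ i : Fin P.d, ∃ s : ℤ, -(r : ℤ) ≤ s ∧ s ≤ r ∧ y i = (((qIdx (hh P k) (x i) : ℤ) - s : ℤ) : ZMod (P.sitesPerDir k))

/-- `Near k x y → NearR k 1 x y`. [folklore] -/
theorem nearR_of_near {x : Site P 0} {y : Site P k} (h : Near k x y) : NearR k 1 x y := by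
  intro i
  obtain ⟨r, hr, e⟩ := h i
  refine ⟨r, ?_, ?_, e⟩ <;> · simp only [trip, mem_insert, mem_singleton] at hr; rcases hr with rfl | rfl | rfl <;> norm_num

/-- Monotonicity in the radius. [folklore] -/
theorem nearR_mono {r r' : ℕ} (hrr : r ≤ r') {x : Site P 0} {y : Site P k} (h : NearR k r x y) : NearR k r' x y := by
  intro i
  obtain ⟨s, h1, h2, e⟩ := h i
  exact ⟨s, by omega, by omega, e⟩

/-- A coarse step of size `≤ r'` in every coordinate composes with `NearR r`. [folklore] -/
theorem nearR_of_coarse_step {r r' : ℕ} {x : Site P 0} {y y' : Site P k} (h : NearR k r x y)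
    (h' : ∀ i : Fin P.d, ∃ s : ℤ, -(r' : ℤ) ≤ s ∧ s ≤ r' ∧ y' i = y i - (s : ZMod (P.sitesPerDir k))) : NearR k (r + r') x y' := by
  intro i
  obtain ⟨s, h1, h2, e⟩ := h i
  obtain ⟨s', h1', h2', e'⟩ := h' i
  refine ⟨s + s', by push_cast; omega, by push_cast; omega, ?_⟩
  rw [e', e]
  push_cast
  ring

/-- One fine step moves the cell index by `0` or `1` (on the circle): `q((x + e_μ)_μ) = q(x_μ)` or `q(x_μ) + 1` in `ZMod N_k`. [folklore] -/
theorem qIdx_shift_cast (hk : k ≤ P.m + P.K) (x : Site P 0) (μ : Fin P.d) :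
    ((qIdx (hh P k) ((x.shift μ) μ) : ℕ) : ZMod (P.sitesPerDir k)) = ((qIdx (hh P k) (x μ) : ℕ) : ZMod (P.sitesPerDir k)) ∨
      ((qIdx (hh P k) ((x.shift μ) μ) : ℕ) : ZMod (P.sitesPerDir k)) = ((qIdx (hh P k) (x μ) : ℕ) : ZMod (P.sitesPerDir k)) + 1 := by
  have hN' := hN k hk
  rw [shift_apply_self]
  have e1 : (x μ + 1 : ZMod (P.sitesPerDir 0)) = x μ + ((1 : ℕ) : ZMod (P.sitesPerDir 0)) := by push_cast; rfl
  rw [e1]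
  by_cases hle : tOff (hh P k) (x μ) + (1 : ℕ) ≤ (hh P k : ℤ)
  · left
    rw [(qIdx_tOff_add_of_le (hh P k) hN' (x μ) 1 hle).1]
  · right
    push Not at hle
    have h1 : (1 : ℕ) ≤ side (hh P k) := side_pos _
    have h2 := (qIdx_tOff_add_of_lt (hh P k) hN' (x μ) 1 h1 hle).1
    exact_mod_cast h2

/-- A fine step of the base site enlarges the radius by at most one: `NearR r (x + e_μ) y → NearR (r+1) x y`. [folklore] -/
theorem nearR_shift (hk : k ≤ P.m + P.K) {r : ℕ} {x : Site P 0} {μ : Fin P.d} {y : Site P k} (h : NearR k r (x.shift μ) y) : NearR k (r + 1) x y := by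
  intro i
  obtain ⟨s, h1, h2, e⟩ := h i
  by_cases hi : i = μ
  · subst hi
    rcases qIdx_shift_cast k hk x i with e0 | e1
    · refine ⟨s, by omega, by omega, ?_⟩
      rw [e]; push_cast; rw [e0]
    · refine ⟨s - 1, by omega, by omega, ?_⟩
      rw [e]; push_cast; rw [e1]; ring
  · refine ⟨s, by omega, by omega, ?_⟩
    rw [e, shift_apply_ne x hi]

/-! ## §5 Locality of the smooth lift -/

section Lift

variable (hk : k ≤ P.m + P.K)
include hk

/-- **★★★ LOCALITY OF THE SUP-SMALL EXACT LIFT**: if `A` and `A'` agree on every coarse bond issuing from a cell within sup-distance `3` of the cell of `b₋`, then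
`liftS k A b = liftS k A' b` — the spread `S1` reads distance `≤ 1`; the smooth coboundary `d(S0 Ψ_k(S1 A))` at `b` reads `Ψ_k` on the cells near `b₋` and near `b₊` (distance `≤ 2`), and
`Ψ_k(S1 A)(y)` reads `S1 A` inside `B^k(y)`, i.e. `A` within distance `1` of `y`. [cite: Balaban1987RG1, (0.4)+(0.11) p.253] -/
theorem liftS_congr_local (A A' : PBond P k → ℝ) (b : PBond P 0) (h : ∀ (y : Site P k) (μ : Fin P.d), NearR k 3 b.src y → A ⟨y, μ⟩ = A' ⟨y, μ⟩) :
    liftS k A b = liftS k A' b := by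
  -- `Ψ_k(S1 A)` and `Ψ_k(S1 A')` agree at every coarse site within distance 2 of the cell of `b₋`
  have hΨ : ∀ y : Site P k, NearR k 2 b.src y → psiIter k (S1 k A) y = psiIter k (S1 k A') y := by
    intro y hy
    refine psiIter_congr_block (S1 k A) (S1 k A') k hk y fun b' hb1 _ => S1_congr_near k A A' b' fun y' hy' => h y' b'.dir ?_
    -- `y'` is near `b'₋`, whose `k`-cell is `y`, which is within distance 2 of the cell of `b₋`
    rw [near_iff_iterBlockOf k hk] at hy'
    refine nearR_mono k (show 2 + 1 ≤ 3 by norm_num) (nearR_of_coarse_step k hy fun i => ?_)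
    obtain ⟨r, hr, e⟩ := hy' i
    refine ⟨r, ?_, ?_, by rw [e, hb1]⟩ <;>
      · simp only [trip, mem_insert, mem_singleton] at hr; rcases hr with rfl | rfl | rfl <;> norm_num
  unfold liftS
  simp only [Pi.add_apply]
  congr 1
  · exact S1_congr_near k A A' b fun y hy => h y b.dir (nearR_mono k (by norm_num) (nearR_of_near k hy))
  · simp only [dgrad]
    congr 1
    · -- at `b₊ = b₋ + e_{dir b}`
      refine S0_congr_near k _ _ _ fun y hy => hΨ y ?_
      have h1 : NearR k 1 (b.src.shift b.dir) y := nearR_of_near k hy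
      exact nearR_shift k hk h1
    · exact S0_congr_near k _ _ _ fun y hy => hΨ y (nearR_mono k (by norm_num) (nearR_of_near k hy))

/-- **VANISHING OFF THE SUPPORT**: if `A ⟨y, μ⟩ = 0` for every cell `y` within sup-distance `3` of the cell of `b₋`, then `liftS k A b = 0`. [cite: Balaban1987RG1, (0.4)+(0.11) p.253] -/
theorem liftS_eq_zero_of_local (A : PBond P k → ℝ) (b : PBond P 0) (h : ∀ (y : Site P k) (μ : Fin P.d), NearR k 3 b.src y → A ⟨y, μ⟩ = 0) : liftS k A b = 0 := by
  have h0 : liftS k (0 : PBond P k → ℝ) = 0 := by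
    have e := liftS_sub k A A
    rwa [sub_self, sub_self] at e
  rw [liftS_congr_local k hk A 0 b fun y μ hy => by rw [h y μ hy]; rfl, h0]
  rfl

/-- **★★ THE LOCAL SUP BOUND OF THE SMOOTH LIFT**: `|liftS k A b| ≤ 18^d(2 + (d+1)18^d)·M/L^k` as soon as `|A ⟨y, μ⟩| ≤ M` for the cells `y` within sup-distance `3` of the cell of `b₋`
(all directions `μ`) — the global bound `abs_liftS_le` applied to `A` cut off outside that neighbourhood. [cite: Balaban1987RG1, (0.4)+(0.11) p.253] -/
theorem abs_liftS_le_local (A : PBond P k → ℝ) (b : PBond P 0) {M : ℝ} (hM : ∀ (y : Site P k) (μ : Fin P.d), NearR k 3 b.src y → |A ⟨y, μ⟩| ≤ M) :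
    |liftS k A b| ≤ (18 : ℝ) ^ P.d * (2 + ((P.d : ℝ) + 1) * (18 : ℝ) ^ P.d) * M / (P.L : ℝ) ^ k := by
  classical
  have hM0 : 0 ≤ M := (abs_nonneg _).trans (hM (iterBlockOf k b.src) b.dir
    (nearR_mono k (by norm_num) (nearR_of_near k (near_self k hk b.src))))
  let A' : PBond P k → ℝ := fun c => if NearR k 3 b.src c.src then A c else 0
  rw [liftS_congr_local k hk A A' b fun y μ hy => by simp only [A', if_pos hy]]
  refine abs_liftS_le k hk A' (fun c => ?_) b
  by_cases hc : NearR k 3 b.src c.src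
  · simp only [A', if_pos hc]; exact hM c.src c.dir hc
  · simp only [A', if_neg hc, abs_zero]; exact hM0

end Lift

end Summit.QuantumFields.YangMills.Theorems.LinearLiftSpread

end
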